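/-
Copyright (c) 2026 The abc-iut branch. All rights reserved.
Released under Apache 2.0 license as described in the file LICENSE.
-/
import Summits.ABC.IUTFork.Repair.Barrier34
import HarnessLib

/-!
# Repair/Barrier35 — the k3 certificate with an ARBITRARY q-blind container hypothesis (graded / windowed (Ind3) containers)

LADDER-ABC:A2.RP, BARRIER track (abc-iut-rp-bar, gen 4), for D-0079 R-H (k3 critic of record = the barrier screen).

Barrier33/34 read a schema-form candidate `H⋆ = X` through the k2 door `QPinned → RP-I05 → X → Licence`. Some R-H rows use a DIFFERENT Θ-side container
in the door — e.g. row 14 «graded-shell-orbit» reads `QPinned → HInd3HullGraded → H⋆ → Licence` with the j-FOLD shell saturation. This file states the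
certificate once for an ARBITRARY container hypothesis `A S P ρ` (a predicate on the setting and the reading, NOT on the q-pilot's Kummer datum) that is
q-move-blind (`A (P.qTwistGlue Λ) ρ ↔ A P ρ` — for every container of record this is `Iff.rfl`, the move rewriting only `qRegionOf`):
from the row's k2 glue `QPinned → A → X → Licence` and ONE bed of the certificate's list (K / TIGHT(e⃗) / TIGHT-HEIGHT(h,e⃗) / COV) at which BOTH `A` and `X` hold,
**`k3_certificate_of_container : ¬ QShellInvariant X ∧ ¬ QScaleInvariant X`**. Barrier34's `k3_certificate_tight/_tightH` are the case `A := RP-I05`.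

Honest framing: candidates and containers are HYPOTHESES (claim-tagged predicates of other files), never asserted; no side taken on [IUTchIII] Cor. 3.12 or on
any author; typed ≠ proved; no new `Prop` facts; axioms {propext, Classical.choice, Quot.sound}. [cite: ScholzeStix2018, §2.2 pp. 9–10]
-/

section

open Set

namespace Summit.ABC.IUTFork.Repair

open Thm311 Cor312 Cor312Vol Literature.IUT.LogThetaLattice Cor312.Checks Cor312.IdentifiedNonVacuity
open Cor312Vol.PinnedWitness Cor312Vol.UnitCoset Cor312Vol.CoveringWitness CandInternal2
open CandMochizuki6Vocabulary (Cand)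

section Container

variable (A : ∀ {T : ThetaIndex} (S : LatticeSituation T) (P : Cor312.Setting S.toSituation)
    (_ρ : (∀ v : T.V, v ∈ T.Vbad → Set (S.L.StarPacket v)) → ∀ (j : T.Label) (vQ : T.VQ), Set (S.L.Packet j vQ)), Prop)
variable (X : ∀ {T : ThetaIndex} (S : LatticeSituation T) (P : Cor312.Setting S.toSituation)
    (_ρ : (∀ v : T.V, v ∈ T.Vbad → Set (S.L.StarPacket v)) → ∀ (j : T.Label) (vQ : T.VQ), Set (S.L.Packet j vQ))
    (_qK : ∀ v : T.V, v ∈ T.Vbad → Set (S.L.StarPacket v)), Prop)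

/-- **k2 through the container `A` ⟹ `SufficientH` for the pair `A ∧ H⋆`.** [folklore] -/
theorem sufficientH_pair_of_k2_container
    (hk2 : ∀ {T : ThetaIndex} (S : LatticeSituation T) (P : Cor312.Setting S.toSituation)
      (ρ : (∀ v : T.V, v ∈ T.Vbad → Set (S.L.StarPacket v)) → ∀ (j : T.Label) (vQ : T.VQ), Set (S.L.Packet j vQ))
      (qK : ∀ v : T.V, v ∈ T.Vbad → Set (S.L.StarPacket v)), QPinned S P ρ qK → A S P ρ → X S P ρ qK → Thm311ToCor312.Licence P) :
    SufficientH (fun _ F P ρ qK => A F.toLatticeSituation P ρ ∧ X F.toLatticeSituation P ρ qK) :=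
  fun _ F P ρ qK _ _ _ _ _ hpin hH => hk2 F.toLatticeSituation P ρ qK hpin.1.2 hH.1 hH.2

/-- A q-move-blind container and a shell-blind `H⋆` make a shell-blind pair. [folklore] -/
theorem qShellInvariant_pair_of_container
    (hA : ∀ {T : ThetaIndex} (F : FullSituation T) (P : Setting F.toLatticeSituation.toSituation)
      (ρ : (∀ v : T.V, v ∈ T.Vbad → Set (F.L.StarPacket v)) → ∀ (j : T.Label) (vQ : T.VQ), Set (F.L.Packet j vQ))
      (Λ : F.L.PacketAut)
      (hmem : ∀ (j : T.Label) (vQ : T.VQ), Λ j vQ '' P.qRegionOf (qPilotObject P.qData) j vQ ∈ (P.frame j vQ).Hul)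
      (hfin : ∀ j : T.Label, (Function.support fun vQ =>
        (F.D P.n).logvol j vQ (Λ j vQ '' P.qRegionOf (qPilotObject P.qData) j vQ)).Finite),
      A F.toLatticeSituation (P.qTwistGlue Λ hmem hfin) ρ ↔ A F.toLatticeSituation P ρ)
    (h : QShellInvariant (fun _ F P ρ qK => X F.toLatticeSituation P ρ qK)) :
    QShellInvariant (fun _ F P ρ qK => A F.toLatticeSituation P ρ ∧ X F.toLatticeSituation P ρ qK) :=
  fun T F P ρ qK Λ hmem hfin hρ hsrc htgt HB hq hΘ hpin HB' hq' hΘ' hpin' =>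
    and_congr (hA F P ρ Λ hmem hfin) (h T F P ρ qK Λ hmem hfin hρ hsrc htgt HB hq hΘ hpin HB' hq' hΘ' hpin')

/-- A q-move-blind container and a scale-blind `H⋆` make a scale-blind pair. [folklore] -/
theorem qScaleInvariant_pair_of_container
    (hA : ∀ {T : ThetaIndex} (F : FullSituation T) (P : Setting F.toLatticeSituation.toSituation)
      (ρ : (∀ v : T.V, v ∈ T.Vbad → Set (F.L.StarPacket v)) → ∀ (j : T.Label) (vQ : T.VQ), Set (F.L.Packet j vQ))
      (Λ : F.L.PacketAut)
      (hmem : ∀ (j : T.Label) (vQ : T.VQ), Λ j vQ '' P.qRegionOf (qPilotObject P.qData) j vQ ∈ (P.frame j vQ).Hul)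
      (hfin : ∀ j : T.Label, (Function.support fun vQ =>
        (F.D P.n).logvol j vQ (Λ j vQ '' P.qRegionOf (qPilotObject P.qData) j vQ)).Finite),
      A F.toLatticeSituation (P.qTwistGlue Λ hmem hfin) ρ ↔ A F.toLatticeSituation P ρ)
    (h : QScaleInvariant (fun _ F P ρ qK => X F.toLatticeSituation P ρ qK)) :
    QScaleInvariant (fun _ F P ρ qK => A F.toLatticeSituation P ρ ∧ X F.toLatticeSituation P ρ qK) :=
  fun T F P ρ qK Λ hmem hfin hρ HB hq hΘ hpin HB' hq' hΘ' hpin' =>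
    and_congr (hA F P ρ Λ hmem hfin) (h T F P ρ qK Λ hmem hfin hρ HB hq hΘ hpin HB' hq' hΘ' hpin')

/-- **THE k3 CERTIFICATE THROUGH AN ARBITRARY q-BLIND CONTAINER.** From (i) a container hypothesis `A` on the Θ-side data and the reading that a q-side move
does not change, (ii) the row's k2 glue `QPinned → A → H⋆ → Licence`, and (iii) ONE bed among K / TIGHT(e⃗) / TIGHT-HEIGHT(h ≥ 1, e⃗) / COV at which `A` AND `H⋆`
hold: `H⋆` is NEITHER shell-blind NOR scale-blind. [folklore] -/
theorem k3_certificate_of_container (p : ℕ) [Fact p.Prime] (h : ℕ) (hh : 0 < h) (e : Checks.toyIndex.Label → ℕ)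
    (hA : ∀ {T : ThetaIndex} (F : FullSituation T) (P : Setting F.toLatticeSituation.toSituation)
      (ρ : (∀ v : T.V, v ∈ T.Vbad → Set (F.L.StarPacket v)) → ∀ (j : T.Label) (vQ : T.VQ), Set (F.L.Packet j vQ))
      (Λ : F.L.PacketAut)
      (hmem : ∀ (j : T.Label) (vQ : T.VQ), Λ j vQ '' P.qRegionOf (qPilotObject P.qData) j vQ ∈ (P.frame j vQ).Hul)
      (hfin : ∀ j : T.Label, (Function.support fun vQ =>
        (F.D P.n).logvol j vQ (Λ j vQ '' P.qRegionOf (qPilotObject P.qData) j vQ)).Finite),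
      A F.toLatticeSituation (P.qTwistGlue Λ hmem hfin) ρ ↔ A F.toLatticeSituation P ρ)
    (hk2 : ∀ {T : ThetaIndex} (S : LatticeSituation T) (P : Cor312.Setting S.toSituation)
      (ρ : (∀ v : T.V, v ∈ T.Vbad → Set (S.L.StarPacket v)) → ∀ (j : T.Label) (vQ : T.VQ), Set (S.L.Packet j vQ))
      (qK : ∀ v : T.V, v ∈ T.Vbad → Set (S.L.StarPacket v)), QPinned S P ρ qK → A S P ρ → X S P ρ qK → Thm311ToCor312.Licence P)
    (hpos :
      (A (UnitCosetCoarse.kFull p).toLatticeSituation (UnitCosetCoarse.kSetting p) (cosetRegion p) ∧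
        X (UnitCosetCoarse.kFull p).toLatticeSituation (UnitCosetCoarse.kSetting p) (cosetRegion p) (idealDatum p)) ∨
      (A (CandInternal2Tight.tightFull p e).toLatticeSituation (CandInternal2Tight.tightSetting p e) (orbitRegion p) ∧
        X (CandInternal2Tight.tightFull p e).toLatticeSituation (CandInternal2Tight.tightSetting p e) (orbitRegion p) (qDatum p)) ∨
      (A (CandInternal2TightHeight.tightHFull p h e).toLatticeSituation (CandInternal2TightHeight.tightHSetting p h e) (orbitRegion p) ∧
        X (CandInternal2TightHeight.tightHFull p h e).toLatticeSituation (CandInternal2TightHeight.tightHSetting p h e) (orbitRegion p)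
          (ProfileHeight.qDatumH p h)) ∨
      (A (covFull p).toLatticeSituation (covSetting p) (rho p) ∧
        X (covFull p).toLatticeSituation (covSetting p) (rho p) (covQK p))) :
    ¬ QShellInvariant (fun _ F P ρ qK => X F.toLatticeSituation P ρ qK) ∧
      ¬ QScaleInvariant (fun _ F P ρ qK => X F.toLatticeSituation P ρ qK) :=
  have hpair := k3_pass_certificate (H := fun _ F P ρ qK => A F.toLatticeSituation P ρ ∧ X F.toLatticeSituation P ρ qK) p h hh e
    hpos (Or.inl (sufficientH_pair_of_k2_container A X hk2))
  ⟨fun hs => hpair.1 (qShellInvariant_pair_of_container A X hA hs),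
    fun hs => hpair.2 (qScaleInvariant_pair_of_container A X hA hs)⟩

end Container

/-- Sanity instance: Barrier34's anchor certificate re-derived through the container form with `A := RP-I05` (cell TIGHT(0,0,3)). [folklore] -/
theorem i06star_scaleSensitive' (p : ℕ) [Fact p.Prime] :
    ¬ QShellInvariant (fun _ F P ρ qK => CandInternal11Gap.HQShellOrbitStar F.toLatticeSituation P ρ qK) ∧
      ¬ QScaleInvariant (fun _ F P ρ qK => CandInternal11Gap.HQShellOrbitStar F.toLatticeSituation P ρ qK) :=
  k3_certificate_of_container HInd3Hull CandInternal11Gap.HQShellOrbitStar p 1 Nat.one_pos (fun j => if j = 2 then 3 else 0)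
    (fun F P ρ Λ hmem hfin => hInd3Hull_qTwistGlue_iff F P ρ Λ hmem hfin)
    (fun S P ρ qK hq hA h => CandInternal11Gap.licence_of_star S P ρ qK hq hA h)
    (Or.inr (Or.inl (i05_and_i06star_holds_tight p _ ⟨by decide, by simp⟩)))

end Summit.ABC.IUTFork.Repair

end
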